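import Summits.KontsevichZagierPeriods.KontsevichZagierPeriods.Theorems.LiouvilleUnfoldingAyoubPiLocalKernelVolumeForm
import Summits.KontsevichZagierPeriods.KontsevichZagierPeriods.Theorems.LiouvilleUnfoldingAyoubPiLocalKernelVolumeDescent
import Summits.KontsevichZagierPeriods.KontsevichZagierPeriods.Theorems.InverseLandauTateLiftingDimZeroRing

/-!
# Item stmt-KontsevichZagierPeriods-0541, line `SketchIdeator2`: the dimension ladder of the crux

Support file (`--supports` stmt-KontsevichZagierPeriods-0541, registered stub
`piLocalKernel_dim_le_iff_volumeForm_succ`).  Write `P := KZ.FormalPeriodRing`, `ϖ := ⟦[π]⟧`, and for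
`d : ℕ` let `F_{≤d} ⊆ KZ.FormalRep` be the subgroup generated by the representations of dimension `≤ d`.
For ANY predicate `Q` on `P` consider

* `(A_d^Q)`  every `c ∈ F_{≤d}` of value `0` has `Q ⟦c⟧`;
* `(B_D^Q)`  any two compact `ℚ`-semialgebraic bodies `K₁, K₂ ⊂ ℝ^D` of non-empty interior and equal
  volume have `Q (⟦K₁⟧ − ⟦K₂⟧)`.

**Theorem (graded Cresson–Viu-Sos principle, `forall_closure_dim_le_iff_forall_bodies_succ`):
`(A_d^Q) ⟺ (B_{d+1}^Q)` for every `d` and every `Q`**, inside the calculus, with no transcendence input: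
* `⟸` (`forall_closure_dim_le_of_forall_bodies_succ`): an element of `F_{≤d}` is `[A] − [B]` modulo
  relations for two BOUNDED volume forms of dimension exactly `d + 1`
  (`exists_isBounded_sub_mem_relations_of_mem_closure_dim_le`: raise generators by unit slabs, apply
  Viu-Sos' sign split / region under the graph / grounding / monomial compression `KZ.exists_sub_isBounded`,
  merge inside one `ℝ^{d+1}` by `KZ.exists_merge₂`), and adding the unit cube to both gives two compact
  bodies of `ℝ^{d+1}` of non-empty interior (`exists_body_eq_add`) with difference `⟦c⟧`;
* `⟹` (`forall_bodies_succ_of_forall_closure_dim_le`, for ALL integrand-`1` representations, compact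
  or not): volumes descend one dimension (`volumeDescent`, p140977: cylindrical decomposition and
  Newton–Leibniz down the inner bands), so `⟦K₁⟧ − ⟦K₂⟧ = ⟦c⟧` with `c ∈ F_{≤d}` of value `0`.

Instances.  `Q x := ∃ N, ϖ ^ N · x = 0` — the crux (Ayoub's Conjecture 7 for the four-move calculus,
`ayoubPiLocalKernel_iff_forall_dim_le`): **`piLocalKernel_dim_le_iff_volumeForm_succ` (registered), the
`[π]`-local kernel statement on `F_{≤d}` is equivalent to the `[π]`-local volume conjecture in `ℝ^{d+1}`**;
`Q x := (x = 0)` — the summit (`summit_iff_forall_dim_le`): `kzKernel_dim_le_iff_volumeConjecture_succ`,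
Conjecture 1 for combinations of dimension `≤ d` is equivalent to Cresson–Viu-Sos' volume conjecture for
compact bodies of `ℝ^{d+1}` (the printed equivalence [Cresson–Viu-Sos 2022, §1] keeps no track of
dimensions); `Q x := ∃ N k, ϖ ^ N · x ^ (k+1) = 0` — the transcendence stub (N) of the line:
`nilLocalKernel_dim_le_iff_nilVolumeForm_succ`.  The rung `d = 0` is a theorem
(`toFormalPeriod_eq_zero_of_mem_closure_dim_zero`: the dimension-zero ring,
`InverseLandau.tateLifting_dimZeroRing`; `equivalent_of_integrand_one_dim_one` re-derives the
dimension-`1` volume form `volumeForm_dim_one`, p140224, without Baker).  **The first open rung `d = 1`: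
the planar volume form — two compact planar `ℚ`-semialgebraic bodies of equal area are (`ϖ`-locally)
move-equivalent — is EXACTLY Conjecture 1 (resp. Conjecture 7) for formal combinations of one-variable
real-algebraic integrands over `ℚ`-semialgebraic subsets of `ℝ`, i.e. for real 1-periods**
(spelled out in `…RungOne.lean`: `volumeConjecture_two_iff_kzKernel_dim_le_one`,
`volumeForm_two_iff_piLocalKernel_dim_le_one`); the rational-integrand part of that rung is a theorem
(Baker, `Dlog.mem_relations_of_eval_eq_zero_of_dim_le_one`, p124986), and the printed transcendence input
for the rest is Huber–Wüstholz' theorem on linear relations of 1-periods, whose transfer into the four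
moves is not in the tree.

References: J. Viu-Sos, IJNT 17 (2021), Thm. 1.1; J. Cresson, J. Viu-Sos, JTNB 34 (2022), §1 p. 326;
J. Ayoub, EMS Newsl. 91 (2014), Conj. 7; A. Huber, G. Wüstholz, *Transcendence and linear relations of
1-periods* (2022); M. Kontsevich, D. Zagier, *Periods* (2001), §1.2.  No definition is introduced
(`F_{≤d}` is spelled out as an `AddSubgroup.closure`).
-/

noncomputable section

open Set MeasureTheory
open Literature.NumberTheory.Transcendental

namespace Summit.KontsevichZagierPeriods.LiouvilleUnfolding.NilradicalCut

open Summit.KontsevichZagierPeriods.LiouvilleUnfolding.PiLocalKernelPosition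
open Summit.KontsevichZagierPeriods.KontsevichZagierPeriods.Theses.LiouvilleUnfolding (AyoubPiLocalKernel)
open Summit.KontsevichZagierPeriods.InverseLandau (tateLifting_dimZeroRing)

/-! ## Bounded decomposition with dimension control -/

/-- **Every element of `F_{≤d}` is a difference of two bounded volume forms of dimension `d + 1`, modulo
relations.**  Generators `[r]`, `dim r = m ≤ d`: raise `r` to dimension `d` by unit slabs
(`KZ.IntegralRep.exists_equivalent_add`, rule (3)) and apply Viu-Sos' bounded decomposition one dimension
up (`KZ.exists_sub_isBounded`: sign split, region under the graph, grounding, monomial compression); sums: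
merge the positive parts and the negative parts separately inside `ℝ^{d+1}` (`KZ.exists_merge₂`, rules
(1), (2)); negatives: swap. [cite: ViuSos2021, Cor. 2.3] -/
theorem exists_isBounded_sub_mem_relations_of_mem_closure_dim_le {d : ℕ} {c : KZ.FormalRep}
    (hc : c ∈ AddSubgroup.closure
      {y : KZ.FormalRep | ∃ (m : ℕ) (r : KZ.IntegralRep m), m ≤ d ∧ y = KZ.of r}) :
    ∃ A B : KZ.IntegralRep (d + 1), Bornology.IsBounded A.domain ∧ Bornology.IsBounded B.domain ∧
      (∀ z ∈ A.domain, A.integrand z = 1) ∧ (∀ z ∈ B.domain, B.integrand z = 1) ∧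
      c - (KZ.of A - KZ.of B) ∈ KZ.relations := by
  induction hc using AddSubgroup.closure_induction with
  | mem y hy =>
    obtain ⟨m, r, hm, rfl⟩ := hy
    obtain ⟨e, rfl⟩ := Nat.exists_eq_add_of_le hm
    obtain ⟨R, hR⟩ := r.exists_equivalent_add e
    obtain ⟨A, B, hAb, hBb, hA1, hB1, eR⟩ := KZ.exists_sub_isBounded R
    refine ⟨A, B, hAb, hBb, hA1, hB1, ?_⟩
    have : KZ.of r - (KZ.of A - KZ.of B) = (KZ.of r - KZ.of R) + (KZ.of R - (KZ.of A - KZ.of B)) := by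
      abel
    rw [this]
    exact KZ.relations.add_mem hR eR
  | zero =>
    refine ⟨KZ.IntegralRep.empty (d + 1), KZ.IntegralRep.empty (d + 1), by simp, by simp, by simp, by simp,
      ?_⟩
    simp
  | add x y _ _ ihx ihy =>
    obtain ⟨A₁, B₁, hA₁b, hB₁b, hA₁1, hB₁1, e₁⟩ := ihx
    obtain ⟨A₂, B₂, hA₂b, hB₂b, hA₂1, hB₂1, e₂⟩ := ihy
    obtain ⟨A, hAb, hA1, eA⟩ := KZ.exists_merge₂ A₁ A₂ hA₁b hA₂b hA₁1 hA₂1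
    obtain ⟨B, hBb, hB1, eB⟩ := KZ.exists_merge₂ B₁ B₂ hB₁b hB₂b hB₁1 hB₂1
    refine ⟨A, B, hAb, hBb, hA1, hB1, ?_⟩
    have : x + y - (KZ.of A - KZ.of B) = (x - (KZ.of A₁ - KZ.of B₁)) + (y - (KZ.of A₂ - KZ.of B₂)) +
        (KZ.of A₁ + KZ.of A₂ - KZ.of A) - (KZ.of B₁ + KZ.of B₂ - KZ.of B) := by abel
    rw [this]
    exact KZ.relations.sub_mem (KZ.relations.add_mem (KZ.relations.add_mem e₁ e₂) eA) eB
  | neg x _ ih =>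
    obtain ⟨A, B, hAb, hBb, hA1, hB1, e⟩ := ih
    refine ⟨B, A, hBb, hAb, hB1, hA1, ?_⟩
    have : -x - (KZ.of B - KZ.of A) = -(x - (KZ.of A - KZ.of B)) := by abel
    rw [this]
    exact KZ.relations.neg_mem e

/-! ## The graded Cresson–Viu-Sos principle for an arbitrary predicate -/

/-- **`(B_{d+1}^Q) ⟹ (A_d^Q)`**: if `Q` holds on the difference of the classes of any two compact bodies of
`ℝ^{d+1}` of non-empty interior and equal volume, then `Q ⟦c⟧` for every `c ∈ F_{≤d}` of value `0`.  Write
`c ≡ [A] − [B]` with bounded volume forms of `ℝ^{d+1}`, add the unit cube to both (`exists_body_eq_add`); the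
two bodies have equal volume by soundness and their difference is `⟦c⟧`. [cite: CressonViusos2022, §1 p. 326] -/
theorem forall_closure_dim_le_of_forall_bodies_succ {d : ℕ} (Q : KZ.FormalPeriodRing → Prop)
    (h : ∀ (K₁ K₂ : KZ.IntegralRep (d + 1)), IsCompact K₁.domain → (interior K₁.domain).Nonempty →
      IsCompact K₂.domain → (interior K₂.domain).Nonempty → (∀ x ∈ K₁.domain, K₁.integrand x = 1) →
      (∀ x ∈ K₂.domain, K₂.integrand x = 1) → K₁.value = K₂.value →
      Q (KZ.toFormalPeriod (KZ.of K₁) - KZ.toFormalPeriod (KZ.of K₂)))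
    {c : KZ.FormalRep}
    (hc : c ∈ AddSubgroup.closure
      {y : KZ.FormalRep | ∃ (m : ℕ) (r : KZ.IntegralRep m), m ≤ d ∧ y = KZ.of r})
    (hv : KZ.eval c = 0) : Q (KZ.toFormalPeriod c) := by
  obtain ⟨A, B, hAb, hBb, hA1, hB1, e⟩ := exists_isBounded_sub_mem_relations_of_mem_closure_dim_le hc
  -- the unit cube `U` of dimension `d + 1`: bounded, integrand `1`, volume `1`
  obtain ⟨U, hUd, hUi⟩ := KZ.exists_oneRep (KZ.isSemialgebraic_cube (n := d + 1))
    (by rw [KZ.volume_cube]; exact ENNReal.one_ne_top)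
  have hUb : Bornology.IsBounded U.domain := by rw [hUd]; exact KZ.isCompact_cube.isBounded
  have hU1 : ∀ z ∈ U.domain, U.integrand z = 1 := fun z _ => by rw [hUi]
  have hUv : 0 < U.value := by
    rw [KZ.IntegralRep.value_eq_volume_real U hU1, hUd, KZ.volume_real_cube]; exact one_pos
  obtain ⟨K₁, h₁c, h₁i, h₁1, h₁⟩ := exists_body_eq_add A U hAb hUb hA1 hU1 hUv
  obtain ⟨K₂, h₂c, h₂i, h₂1, h₂⟩ := exists_body_eq_add B U hBb hUb hB1 hU1 hUv
  have hcAB : KZ.toFormalPeriod c = KZ.toFormalPeriod (KZ.of A) - KZ.toFormalPeriod (KZ.of B) := by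
    rw [← map_sub, KZ.toFormalPeriod_eq_iff]
    exact e
  have hK : KZ.toFormalPeriod (KZ.of K₁) - KZ.toFormalPeriod (KZ.of K₂) = KZ.toFormalPeriod c := by
    rw [h₁, h₂, hcAB]; ring
  have hval : K₁.value = K₂.value := by
    have h0 := congrArg KZ.evalP hK
    rw [map_sub, KZ.evalP_toFormalPeriod_of, KZ.evalP_toFormalPeriod_of, KZ.evalP_toFormalPeriod, hv] at h0
    linarith
  rw [← hK]
  exact h K₁ K₂ h₁c h₁i h₂c h₂i h₁1 h₂1 hval

/-- **`(A_d^Q) ⟹ (B_{d+1}^Q)`, for all finite volumes**: if `Q ⟦c⟧` for every `c ∈ F_{≤d}` of value `0`,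
then `Q (⟦K₁⟧ − ⟦K₂⟧)` for ANY two integrand-`1` representations of `ℝ^{d+1}` of equal (finite) volume,
compact or not: both descend to `F_{≤d}` modulo relations (`volumeDescent`), and the difference of the
descended elements has value `0`. [cite: KontsevichZagier2001, §1.2 rules (1),(3)] -/
theorem forall_bodies_succ_of_forall_closure_dim_le {d : ℕ} (Q : KZ.FormalPeriodRing → Prop)
    (h : ∀ c ∈ AddSubgroup.closure
      {y : KZ.FormalRep | ∃ (m : ℕ) (r : KZ.IntegralRep m), m ≤ d ∧ y = KZ.of r},
      KZ.eval c = 0 → Q (KZ.toFormalPeriod c))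
    (K₁ K₂ : KZ.IntegralRep (d + 1)) (h₁ : ∀ x ∈ K₁.domain, K₁.integrand x = 1)
    (h₂ : ∀ x ∈ K₂.domain, K₂.integrand x = 1) (hv : K₁.value = K₂.value) :
    Q (KZ.toFormalPeriod (KZ.of K₁) - KZ.toFormalPeriod (KZ.of K₂)) := by
  obtain ⟨c₁, hc₁, e₁⟩ := volumeDescent d K₁ h₁
  obtain ⟨c₂, hc₂, e₂⟩ := volumeDescent d K₂ h₂
  have hle : AddSubgroup.closure (Set.range fun b : KZ.IntegralRep d => KZ.of b) ≤
      AddSubgroup.closure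
        {y : KZ.FormalRep | ∃ (m : ℕ) (r : KZ.IntegralRep m), m ≤ d ∧ y = KZ.of r} :=
    AddSubgroup.closure_mono (by rintro _ ⟨b, rfl⟩; exact ⟨d, b, le_rfl, rfl⟩)
  have hc : c₁ - c₂ ∈ AddSubgroup.closure
      {y : KZ.FormalRep | ∃ (m : ℕ) (r : KZ.IntegralRep m), m ≤ d ∧ y = KZ.of r} :=
    sub_mem (hle hc₁) (hle hc₂)
  have hv' : KZ.eval (c₁ - c₂) = 0 := by
    have f₁ := KZ.relations_le_ker_eval_holds e₁
    have f₂ := KZ.relations_le_ker_eval_holds e₂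
    rw [AddMonoidHom.mem_ker, map_sub, KZ.eval_of] at f₁ f₂
    rw [map_sub]
    linarith
  have hK : KZ.toFormalPeriod (KZ.of K₁) - KZ.toFormalPeriod (KZ.of K₂) = KZ.toFormalPeriod (c₁ - c₂) := by
    rw [map_sub]
    congr 1
    · rw [KZ.toFormalPeriod_eq_iff]; exact e₁
    · rw [KZ.toFormalPeriod_eq_iff]; exact e₂
  rw [hK]
  exact h _ hc hv'

/-- **The graded Cresson–Viu-Sos principle**: for every `d` and every predicate `Q` on the formal period
ring, `(A_d^Q) ⟺ (B_{d+1}^Q)` — a property of the classes of value `0` generated in dimension `≤ d` is the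
same property of differences of equal-volume compact bodies of `ℝ^{d+1}`. [cite: CressonViusos2022, §1 p. 326] -/
theorem forall_closure_dim_le_iff_forall_bodies_succ (d : ℕ) (Q : KZ.FormalPeriodRing → Prop) :
    (∀ c ∈ AddSubgroup.closure
        {y : KZ.FormalRep | ∃ (m : ℕ) (r : KZ.IntegralRep m), m ≤ d ∧ y = KZ.of r},
        KZ.eval c = 0 → Q (KZ.toFormalPeriod c)) ↔
      ∀ (K₁ K₂ : KZ.IntegralRep (d + 1)), IsCompact K₁.domain → (interior K₁.domain).Nonempty →
        IsCompact K₂.domain → (interior K₂.domain).Nonempty → (∀ x ∈ K₁.domain, K₁.integrand x = 1) →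
        (∀ x ∈ K₂.domain, K₂.integrand x = 1) → K₁.value = K₂.value →
        Q (KZ.toFormalPeriod (KZ.of K₁) - KZ.toFormalPeriod (KZ.of K₂)) :=
  ⟨fun h K₁ K₂ _ _ _ _ h₁ h₂ hv => forall_bodies_succ_of_forall_closure_dim_le Q h K₁ K₂ h₁ h₂ hv,
    fun h _ hc hv => forall_closure_dim_le_of_forall_bodies_succ Q h hc hv⟩

/-- **Compactness is immaterial**: in dimension `d + 1`, `Q` on differences of equal-volume compact bodies
of non-empty interior is equivalent to `Q` on differences of ALL pairs of equal-volume integrand-`1`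
representations (both being `(A_d^Q)`). [cite: CressonViusos2022, §1 p. 326] -/
theorem forall_bodies_succ_iff_forall_integrand_one_succ (d : ℕ) (Q : KZ.FormalPeriodRing → Prop) :
    (∀ (K₁ K₂ : KZ.IntegralRep (d + 1)), IsCompact K₁.domain → (interior K₁.domain).Nonempty →
        IsCompact K₂.domain → (interior K₂.domain).Nonempty → (∀ x ∈ K₁.domain, K₁.integrand x = 1) →
        (∀ x ∈ K₂.domain, K₂.integrand x = 1) → K₁.value = K₂.value →
        Q (KZ.toFormalPeriod (KZ.of K₁) - KZ.toFormalPeriod (KZ.of K₂))) ↔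
      ∀ (K₁ K₂ : KZ.IntegralRep (d + 1)), (∀ x ∈ K₁.domain, K₁.integrand x = 1) →
        (∀ x ∈ K₂.domain, K₂.integrand x = 1) → K₁.value = K₂.value →
        Q (KZ.toFormalPeriod (KZ.of K₁) - KZ.toFormalPeriod (KZ.of K₂)) :=
  ⟨fun h K₁ K₂ h₁ h₂ hv => forall_bodies_succ_of_forall_closure_dim_le Q
      (fun _ hc hv' => forall_closure_dim_le_of_forall_bodies_succ Q h hc hv') K₁ K₂ h₁ h₂ hv,
    fun h K₁ K₂ _ _ _ _ h₁ h₂ hv => h K₁ K₂ h₁ h₂ hv⟩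

/-! ## The rungs get harder with the dimension -/

/-- `(A_{d'}^Q) ⟹ (A_d^Q)` for `d ≤ d'` (`F_{≤d} ⊆ F_{≤d'}`). [folklore] -/
theorem forall_closure_dim_le_mono {d d' : ℕ} (hdd' : d ≤ d') (Q : KZ.FormalPeriodRing → Prop)
    (h : ∀ c ∈ AddSubgroup.closure
      {y : KZ.FormalRep | ∃ (m : ℕ) (r : KZ.IntegralRep m), m ≤ d' ∧ y = KZ.of r},
      KZ.eval c = 0 → Q (KZ.toFormalPeriod c)) :
    ∀ c ∈ AddSubgroup.closure
      {y : KZ.FormalRep | ∃ (m : ℕ) (r : KZ.IntegralRep m), m ≤ d ∧ y = KZ.of r},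
      KZ.eval c = 0 → Q (KZ.toFormalPeriod c) :=
  fun c hc hv => h c (AddSubgroup.closure_mono
    (by rintro _ ⟨m, r, hm, hy⟩; exact ⟨m, r, hm.trans hdd', hy⟩) hc) hv

/-- **The volume forms get harder with the dimension**: `(B_{d'+1}^Q) ⟹ (B_{d+1}^Q)` for `d ≤ d'` — through
the ladder, `(B_{d'+1}^Q) ⟺ (A_{d'}^Q) ⟹ (A_d^Q) ⟺ (B_{d+1}^Q)` (directly: thicken both bodies by unit
slabs). In particular a planar counterexample to the volume conjecture yields one in every dimension `≥ 2`.
[cite: CressonViusos2022, §1 p. 326] -/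
theorem forall_bodies_succ_mono {d d' : ℕ} (hdd' : d ≤ d') (Q : KZ.FormalPeriodRing → Prop)
    (h : ∀ (K₁ K₂ : KZ.IntegralRep (d' + 1)), IsCompact K₁.domain → (interior K₁.domain).Nonempty →
      IsCompact K₂.domain → (interior K₂.domain).Nonempty → (∀ x ∈ K₁.domain, K₁.integrand x = 1) →
      (∀ x ∈ K₂.domain, K₂.integrand x = 1) → K₁.value = K₂.value →
      Q (KZ.toFormalPeriod (KZ.of K₁) - KZ.toFormalPeriod (KZ.of K₂)))
    (K₁ K₂ : KZ.IntegralRep (d + 1)) (h₁ : ∀ x ∈ K₁.domain, K₁.integrand x = 1)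
    (h₂ : ∀ x ∈ K₂.domain, K₂.integrand x = 1) (hv : K₁.value = K₂.value) :
    Q (KZ.toFormalPeriod (KZ.of K₁) - KZ.toFormalPeriod (KZ.of K₂)) :=
  forall_bodies_succ_of_forall_closure_dim_le Q
    (forall_closure_dim_le_mono hdd' Q fun _ hc hv' => forall_closure_dim_le_of_forall_bodies_succ Q h hc hv')
    K₁ K₂ h₁ h₂ hv

/-! ## The three instances: crux, summit, transcendence stub -/

/-- **Registered stub `piLocalKernel_dim_le_iff_volumeForm_succ` — the dimension ladder of item 0541.**
For every `d`, the `[π]`-local kernel statement restricted to formal `ℤ`-combinations of representations of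
dimension `≤ d` is EQUIVALENT to the `[π]`-local volume conjecture for compact `ℚ`-semialgebraic bodies of
`ℝ^{d+1}` of non-empty interior (`forall_closure_dim_le_iff_forall_bodies_succ` with `Q x := ∃ N, ϖ^N x = 0`).
No transcendence input. [cite: CressonViusos2022, §1 p. 326] -/
theorem piLocalKernel_dim_le_iff_volumeForm_succ : ∀ d : ℕ, (∀ c ∈ AddSubgroup.closure {y : KZ.FormalRep | ∃ (m : ℕ) (r : KZ.IntegralRep m), m ≤ d ∧ y = KZ.of r}, KZ.eval c = 0 → ∃ N : ℕ, KZ.toFormalPeriod (KZ.of KZ.piRep) ^ N * KZ.toFormalPeriod c = 0) ↔ ∀ (K₁ K₂ : KZ.IntegralRep (d + 1)), IsCompact K₁.domain → (interior K₁.domain).Nonempty → IsCompact K₂.domain → (interior K₂.domain).Nonempty → (∀ x ∈ K₁.domain, K₁.integrand x = 1) → (∀ x ∈ K₂.domain, K₂.integrand x = 1) → K₁.value = K₂.value → ∃ N : ℕ, KZ.toFormalPeriod (KZ.of KZ.piRep) ^ N * (KZ.toFormalPeriod (KZ.of K₁) - KZ.toFormalPeriod (KZ.of K₂)) = 0 :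=
  fun d => forall_closure_dim_le_iff_forall_bodies_succ d
    fun x => ∃ N : ℕ, KZ.toFormalPeriod (KZ.of KZ.piRep) ^ N * x = 0

/-- **The summit, graded: Conjecture 1 on `F_{≤d}` ⟺ Cresson–Viu-Sos' volume conjecture in `ℝ^{d+1}`.**
For every `d`, "every formal combination of representations of dimension `≤ d` with value `0` is a
relation" is equivalent to "two compact `ℚ`-semialgebraic bodies of `ℝ^{d+1}` of non-empty interior and
equal volume are move-equivalent" (`Q x := (x = 0)`).  The printed equivalence "Conjecture 1 ⇔ volume
conjecture" [Cresson–Viu-Sos 2022, §1 p. 326; `KZ.kzPeriodConjecture'_iff_volumeConjectureCompact_holds`]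
keeps no track of dimensions. [cite: CressonViusos2022, §1 p. 326 Conjecture] -/
theorem kzKernel_dim_le_iff_volumeConjecture_succ (d : ℕ) :
    (∀ c ∈ AddSubgroup.closure
        {y : KZ.FormalRep | ∃ (m : ℕ) (r : KZ.IntegralRep m), m ≤ d ∧ y = KZ.of r},
        KZ.eval c = 0 → c ∈ KZ.relations) ↔
      ∀ (K₁ K₂ : KZ.IntegralRep (d + 1)), IsCompact K₁.domain → (interior K₁.domain).Nonempty →
        IsCompact K₂.domain → (interior K₂.domain).Nonempty → (∀ x ∈ K₁.domain, K₁.integrand x = 1) →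
        (∀ x ∈ K₂.domain, K₂.integrand x = 1) → K₁.value = K₂.value → KZ.Equivalent K₁ K₂ := by
  have key := forall_closure_dim_le_iff_forall_bodies_succ d fun x => x = 0
  simp only [sub_eq_zero, KZ.toFormalPeriod_eq_zero_iff, KZ.toFormalPeriod_eq_iff] at key
  exact key

/-- **The transcendence stub (N), graded**: "every class of value `0` generated in dimension `≤ d` is
`ϖ`-locally nilpotent" is equivalent to "the difference of two equal-volume compact bodies of `ℝ^{d+1}` is
`ϖ`-locally nilpotent" (`Q x := ∃ N k, ϖ^N x^(k+1) = 0`; compare `nilLocalKernel_iff_volumeForm`). [folklore] -/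
theorem nilLocalKernel_dim_le_iff_nilVolumeForm_succ (d : ℕ) :
    (∀ c ∈ AddSubgroup.closure
        {y : KZ.FormalRep | ∃ (m : ℕ) (r : KZ.IntegralRep m), m ≤ d ∧ y = KZ.of r},
        KZ.eval c = 0 →
          ∃ N k : ℕ, KZ.toFormalPeriod (KZ.of KZ.piRep) ^ N * KZ.toFormalPeriod c ^ (k + 1) = 0) ↔
      ∀ (K₁ K₂ : KZ.IntegralRep (d + 1)), IsCompact K₁.domain → (interior K₁.domain).Nonempty →
        IsCompact K₂.domain → (interior K₂.domain).Nonempty → (∀ x ∈ K₁.domain, K₁.integrand x = 1) →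
        (∀ x ∈ K₂.domain, K₂.integrand x = 1) → K₁.value = K₂.value →
        ∃ N k : ℕ, KZ.toFormalPeriod (KZ.of KZ.piRep) ^ N *
          (KZ.toFormalPeriod (KZ.of K₁) - KZ.toFormalPeriod (KZ.of K₂)) ^ (k + 1) = 0 :=
  forall_closure_dim_le_iff_forall_bodies_succ d
    fun x => ∃ N k : ℕ, KZ.toFormalPeriod (KZ.of KZ.piRep) ^ N * x ^ (k + 1) = 0

/-! ## The crux and the summit along the ladder -/

/-- Every formal combination lies in some `F_{≤d}`. [folklore] -/
theorem exists_mem_closure_dim_le (c : KZ.FormalRep) :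
    ∃ d : ℕ, c ∈ AddSubgroup.closure
      {y : KZ.FormalRep | ∃ (m : ℕ) (r : KZ.IntegralRep m), m ≤ d ∧ y = KZ.of r} := by
  have hmono : ∀ {d d' : ℕ}, d ≤ d' → AddSubgroup.closure
      {y : KZ.FormalRep | ∃ (m : ℕ) (r : KZ.IntegralRep m), m ≤ d ∧ y = KZ.of r} ≤
      AddSubgroup.closure {y : KZ.FormalRep | ∃ (m : ℕ) (r : KZ.IntegralRep m), m ≤ d' ∧ y = KZ.of r} :=
    fun hdd' => AddSubgroup.closure_mono fun y ⟨m, r, hm, hy⟩ => ⟨m, r, hm.trans hdd', hy⟩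
  induction c using FreeAbelianGroup.induction_on with
  | zero => exact ⟨0, AddSubgroup.zero_mem _⟩
  | of x =>
    obtain ⟨m, r⟩ := x
    exact ⟨m, AddSubgroup.subset_closure ⟨m, r, le_rfl, rfl⟩⟩
  | neg x ih =>
    obtain ⟨d, hd⟩ := ih
    exact ⟨d, AddSubgroup.neg_mem _ hd⟩
  | add x y ihx ihy =>
    obtain ⟨d, hd⟩ := ihx
    obtain ⟨d', hd'⟩ := ihy
    exact ⟨max d d', AddSubgroup.add_mem _ (hmono (le_max_left d d') hd) (hmono (le_max_right d d') hd')⟩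

/-- **The crux is the conjunction of its rungs**: item 0541 holds iff `(A_d)` holds for every `d`, hence (by
the ladder) iff the `[π]`-local volume conjecture holds in every dimension `d + 1`. [cite: Ayoub2014, Conj. 7] -/
theorem ayoubPiLocalKernel_iff_forall_dim_le :
    AyoubPiLocalKernel ↔ ∀ (d : ℕ), ∀ c ∈ AddSubgroup.closure
      {y : KZ.FormalRep | ∃ (m : ℕ) (r : KZ.IntegralRep m), m ≤ d ∧ y = KZ.of r},
      KZ.eval c = 0 → ∃ N : ℕ, KZ.toFormalPeriod (KZ.of KZ.piRep) ^ N * KZ.toFormalPeriod c = 0 := by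
  rw [ayoubPiLocalKernel_iff_piLocalKernel, piLocalKernel_iff_forall_evalP]
  constructor
  · intro h d c _ hv
    exact h _ (by rw [KZ.evalP_toFormalPeriod, hv])
  · intro h x hx
    obtain ⟨c, rfl⟩ := KZ.toFormalPeriod_surjective x
    obtain ⟨d, hd⟩ := exists_mem_closure_dim_le c
    exact h d c hd (by rwa [KZ.evalP_toFormalPeriod] at hx)

/-- **The summit is the conjunction of its rungs**: the Kontsevich–Zagier period conjecture (for this
calculus) holds iff Conjecture 1 holds on `F_{≤d}` for every `d`, hence iff Cresson–Viu-Sos' volume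
conjecture holds in every dimension `d + 1`. [cite: CressonViusos2022, §1 p. 326] -/
theorem summit_iff_forall_dim_le :
    KontsevichZagierPeriods ↔ ∀ (d : ℕ), ∀ c ∈ AddSubgroup.closure
      {y : KZ.FormalRep | ∃ (m : ℕ) (r : KZ.IntegralRep m), m ≤ d ∧ y = KZ.of r},
      KZ.eval c = 0 → c ∈ KZ.relations := by
  refine Iff.trans (kzKernelConjecture_iff_isRational : KZKernelConjecture ↔ KontsevichZagierPeriods).symm ?_
  constructor
  · intro h d c _ hv
    exact h c hv
  · intro h c hc
    obtain ⟨d, hd⟩ := exists_mem_closure_dim_le c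
    exact h d c hd hc

/-! ## The bottom rung `d = 0` is a theorem -/

/-- **`(A_0)` holds, with exponent `0`**: a formal combination of dimension-zero representations
(real-algebraic constants over the point `ℝ⁰`) of value `0` is a relation — its class lies in the
dimension-zero ring, on which `evalP` is injective (`InverseLandau.tateLifting_dimZeroRing`).
[cite: KontsevichZagier2001, §1.2] -/
theorem toFormalPeriod_eq_zero_of_mem_closure_dim_zero {c : KZ.FormalRep}
    (hc : c ∈ AddSubgroup.closure
      {y : KZ.FormalRep | ∃ (m : ℕ) (r : KZ.IntegralRep m), m ≤ 0 ∧ y = KZ.of r})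
    (hv : KZ.eval c = 0) : KZ.toFormalPeriod c = 0 := by
  have hmem : KZ.toFormalPeriod c ∈
      Subring.closure (Set.range fun b : KZ.IntegralRep 0 => KZ.toFormalPeriod (KZ.of b)) := by
    clear hv
    induction hc using AddSubgroup.closure_induction with
    | mem y hy =>
      obtain ⟨m, r, hm, rfl⟩ := hy
      obtain rfl : m = 0 := Nat.le_zero.mp hm
      exact Subring.subset_closure ⟨r, rfl⟩
    | zero => rw [map_zero]; exact Subring.zero_mem _
    | add x y _ _ hx hy => rw [map_add]; exact Subring.add_mem _ hx hy
    | neg x _ hx => rw [map_neg]; exact Subring.neg_mem _ hx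
  exact (tateLifting_dimZeroRing _ hmem).2.2 (by rw [KZ.evalP_toFormalPeriod, hv])

/-- **Volume conjecture in dimension `1`, all finite lengths, from the dimension-zero ring**: two
integrand-`1` representations on `ℚ`-semialgebraic subsets of the line of equal length are move-equivalent
(the rung `d = 0`: `forall_bodies_succ_of_forall_closure_dim_le` with `(A_0)`; a Baker-free proof of
`volumeForm_dim_one`, p140224). [cite: KontsevichZagier2001, §1.2 Conjecture 1] -/
theorem equivalent_of_integrand_one_dim_one (K₁ K₂ : KZ.IntegralRep 1)
    (h₁ : ∀ x ∈ K₁.domain, K₁.integrand x = 1) (h₂ : ∀ x ∈ K₂.domain, K₂.integrand x = 1)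
    (hv : K₁.value = K₂.value) : KZ.Equivalent K₁ K₂ := by
  have key : KZ.toFormalPeriod (KZ.of K₁) - KZ.toFormalPeriod (KZ.of K₂) = 0 :=
    forall_bodies_succ_of_forall_closure_dim_le (fun x => x = 0)
      (fun _ hc hv' => toFormalPeriod_eq_zero_of_mem_closure_dim_zero hc hv') K₁ K₂ h₁ h₂ hv
  rwa [sub_eq_zero, KZ.toFormalPeriod_eq_iff] at key

end Summit.KontsevichZagierPeriods.LiouvilleUnfolding.NilradicalCut

end
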